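import Literature.IUT.LogThetaLattice.LocalLogShells
import Literature.IUT.LogThetaLattice.TensorPackets
import Mathlib.Analysis.SpecialFunctions.Log.Basic
import HarnessLib

/-!
# [IUTchIII] Proposition 3.7 (ii) / Example 3.6 (ii) at the model of an ARCHIMEDEAN place: the local
# fractional ideals `𝔍_v = λ·𝒪_{K_v} ⊆ K_v = ℂ`, their dictionary with `Γ_v = ℝ`, and `𝔍_v ⊆ 𝓘^ℚ` with
# `ℚ`-span all of `𝓘^ℚ`

Proof-only companion (abc-iut cell, layer L6, wave-4 discharge seat abc-iut-w4-d013 gen 3; node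
IUTchIII:Prop3.7(ii)), archimedean twin of abc-iut-w4-d005's `ThetaPilotObjectsProp37iiProofs.lean`, whose
HONEST SCOPE defers exactly this: "the archimedean `𝔍_v` ('a positive real multiple of `𝒪_{K_v}`') is not
treated here". NO new definitions: the archimedean model of one factor is abc-iut-L6-t3's
`LocalLogShells.lean` ([IUTchIII] Rmk. 1.2.2 (ii): `k = ℂ`, `𝒪_k = arcIntegers = {|a| ≤ 1}`, log-shell
`ℐ_k = arcLogShell = {|a| ≤ π}`), and `𝓘^ℚ` is abc-iut-L6-t4's `shellQSpan` (`TensorPackets.lean`, [IUTchIII]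
Prop. 3.2 (ii): the `𝕜`-span of the subgroup generated by the log-shell; at an archimedean place print's `ℚ`-span
and the `ℝ`-span coincide — here both are ALL of `K_v`, see `addSubgroupClosure_arcLogShell_eq_top`).

S. Mochizuki, *Inter-universal Teichmüller Theory III*, kurims manuscript (May 2020) [claim key Mochizuki2012,
status disputed (D-0012)], read on the cell render `lit/renders/IUTchIII-kurims-url-4b091feeb646`:
* Example 3.6 (ii), p. 107 l. 57–64: an object of `𝓕⊛_𝔪𝔬𝔡` is a collection of "fractional ideals" `𝔍_v ⊆ K_v`
  — "a positive real multiple of `𝒪_{K_v} = {λ ∈ K_v | |λ| ≤ 1} ⊆ K_v` when `v ∈ 𝕍^arc`"; "for any element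
  `f ∈ F^×_mod`, one obtains an object `f·𝔍 = {f·𝔍_v}`"; "for any `n ∈ ℤ` … the `n`-th tensor power `𝔍^{⊗n}`";
  p. 108 l. 1–3: an elementary morphism `𝔍₁ → 𝔍₂` is "an element `f ∈ F^×_mod` that is integral with respect to
  `𝔍₁` and `𝔍₂` in the sense that `f·𝔍_{1,v} ⊆ 𝔍_{2,v}` for each `v ∈ 𝕍`".
* Proposition 3.7 (ii), p. 110 l. 29–44: "the corresponding local 'fractional ideal `𝔍_v`' of Example 3.6,
  (ii), is a subset [indeed a submodule when `v ∈ 𝕍^non`] of `𝓘^ℚ(^{A,α}𝓕_v)` whose `ℚ`-span is equal to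
  `𝓘^ℚ(^{A,α}𝓕_v)` [cf. the notational conventions of Proposition 3.2, (ii)]".

WHAT IS PROVED (elementary complex analysis; `λ, λ₁, λ₂ > 0` real, `f ∈ ℂ`):
* `smul_arcIntegers_eq_closedBall` — `λ·𝒪_{K_v}` is the closed disc of radius `λ`; `unit_smul_arcIntegers` —
  `u·𝒪_{K_v} = 𝒪_{K_v}` for `|u| = 1` (the units act trivially on the local fractional ideals: the SET `f·𝔍_v`
  depends on `f` only through `|f|_v`, i.e. through `β_v(f) = −log |f|_v`);
* **the archimedean half of the dictionary of abc-iut-L6-t6's `GlobalFrobenioidModels.lean`** (module doc: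
  "`𝔍_v = λ·𝒪_{K_v}` is the same thing as the class `[λ] ∈ Γ_v`, and `f·𝔍_{1,v} ⊆ 𝔍_{2,v}` ⟺
  `β_v(f) + [λ₁] − [λ₂] ∈ Γ_v^{≥0}`", with `Γ_v ≅ ℝ` via `−log |·|` at archimedean `v`), there RECORDED, here
  PROVED for the literal subsets of `ℂ`: `smul_smul_arcIntegers_subset_iff` (`f·(λ₁𝒪) ⊆ λ₂𝒪 ⟺ |f|·λ₁ ≤ λ₂`),
  `smul_smul_arcIntegers_subset_iff_log` (⟺ `0 ≤ −log |f| + (−log λ₁) − (−log λ₂)` for `f ≠ 0`),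
  `smul_arcIntegers_eq_iff` (`λ₁𝒪 = λ₂𝒪 ⟺ λ₁ = λ₂`: the class is well defined), `smul_arcIntegers_mul`
  (`(λ₁𝒪)·(λ₂𝒪) = (λ₁λ₂)𝒪`: tensor powers/products ↔ addition of classes);
* **Prop. 3.7 (ii)'s parenthetical at `v ∈ 𝕍^arc`**: `addSubgroupClosure_arcLogShell_eq_top` (already the
  subgroup generated by the log-shell `ℐ = {|a| ≤ π}` is all of `K_v`), hence `shellQSpan_arcLogShell_eq_top`
  (`𝓘^ℚ = K_v` for every coefficient field `𝕜`), `smul_arcIntegers_subset_shellQSpan` ("is a subset of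
  `𝓘^ℚ`"), `span_rat_smul_arcIntegers_eq_top` / `span_real_smul_arcIntegers_eq_top` /
  `span_rat_smul_arcIntegers_eq_shellQSpan` ("whose `ℚ`-span is equal to `𝓘^ℚ`", literal `ℚ`-span and
  abc-iut-L6-t4's `𝕜`-span);
* **why print restricts "indeed a submodule" to `v ∈ 𝕍^non`**: `not_addClosed_smul_arcIntegers` — at an
  archimedean place `λ·𝒪_{K_v}` is NOT closed under addition (`λ + λ = 2λ ∉ λ·𝒪_{K_v}`), although it is stable
  under multiplication by `𝒪_{K_v}` (`mul_mem_smul_arcIntegers`) — contrast abc-iut-w4-d005's ultrametric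
  `add_mem_smul_closedBall`.

HONEST SCOPE: one factor at one archimedean place (`K_v = ℂ`; a real place embeds by restriction); packets are
images under abc-iut-L6-t4's `toPacketAt` as in the nonarchimedean twin. Nothing in this file takes a side on
[IUTchIII] Cor. 3.12; typed ≠ discharged elsewhere; what is proved is classical.
-/

noncomputable section

namespace Literature.IUT.LogThetaLattice

open Set Metric
open scoped Pointwise

section ArchPlace

/-! ### The archimedean local fractional ideals `λ·𝒪_{K_v}` as subsets of `ℂ` -/

/-- Membership in `𝒪_{K_v} = arcIntegers`: `|a| ≤ 1`. [claim: Mochizuki2012, status: disputed] -/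
theorem mem_arcIntegers_iff {a : ℂ} : a ∈ arcIntegers ↔ ‖a‖ ≤ 1 := Iff.rfl

/-- `𝒪_{K_v}` is the closed unit disc. [claim: Mochizuki2012, status: disputed] -/
theorem arcIntegers_eq_closedBall : arcIntegers = closedBall (0 : ℂ) 1 := by
  ext a; simp [mem_arcIntegers_iff, mem_closedBall, dist_zero_right]

/-- **[IUTchIII] Ex. 3.6 (ii), `v ∈ 𝕍^arc`: "a positive real multiple of `𝒪_{K_v}`" is a closed disc** —
`λ·𝒪_{K_v} = {|z| ≤ λ}` for `λ > 0`. [claim: Mochizuki2012, status: disputed] -/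
theorem smul_arcIntegers_eq_closedBall {lam : ℝ} (hlam : 0 < lam) :
    (lam : ℂ) • arcIntegers = closedBall (0 : ℂ) lam := by
  ext z
  rw [mem_closedBall, dist_zero_right]
  constructor
  · intro hz
    obtain ⟨a, ha, rfl⟩ := mem_smul_set.mp hz
    rw [mem_arcIntegers_iff] at ha
    rw [smul_eq_mul, norm_mul, Complex.norm_real, Real.norm_of_nonneg hlam.le]
    exact mul_le_of_le_one_right hlam.le ha
  · intro hz
    have h0 : (lam : ℂ) ≠ 0 := by exact_mod_cast hlam.ne'
    refine mem_smul_set.mpr ⟨(lam : ℂ)⁻¹ * z, ?_, ?_⟩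
    · rw [mem_arcIntegers_iff, norm_mul, norm_inv, Complex.norm_real, Real.norm_of_nonneg hlam.le]
      rw [inv_mul_le_iff₀ hlam, mul_one]
      exact hz
    · rw [smul_eq_mul, ← mul_assoc, mul_inv_cancel₀ h0, one_mul]

/-- Membership in `λ·𝒪_{K_v}` (`λ > 0`): `|z| ≤ λ`. [claim: Mochizuki2012, status: disputed] -/
theorem mem_smul_arcIntegers_iff {lam : ℝ} (hlam : 0 < lam) {z : ℂ} :
    z ∈ (lam : ℂ) • arcIntegers ↔ ‖z‖ ≤ lam := by
  rw [smul_arcIntegers_eq_closedBall hlam, mem_closedBall, dist_zero_right]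

/-- The generator lies in its fractional ideal: `λ = λ·1 ∈ λ·𝒪_{K_v}` (any `λ ∈ ℂ`) — so a fractional ideal
"generated by [an] element of the monoid" ([IUTchIII] Prop. 3.7 (v) p. 112) contains that element.
[claim: Mochizuki2012, status: disputed] -/
theorem self_mem_smul_arcIntegers (lam : ℂ) : lam ∈ lam • arcIntegers :=
  mem_smul_set.mpr ⟨1, by simp [mem_arcIntegers_iff], by rw [smul_eq_mul, mul_one]⟩

/-- **The units act trivially**: `u·𝒪_{K_v} = 𝒪_{K_v}` for `|u| = 1` (rotation invariance of the disc) — the SET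
`f·𝔍_v` depends on `f` only through `|f|_v`, i.e. through `β_v(f) = −log |f|_v` ([IUTchIII] Ex. 3.6 (i) p. 107,
`β_v` "determined by the valuation"). [claim: Mochizuki2012, status: disputed] -/
theorem unit_smul_arcIntegers {u : ℂ} (hu : ‖u‖ = 1) : u • arcIntegers = arcIntegers := by
  have hu0 : u ≠ 0 := fun h => by simp [h] at hu
  ext z
  constructor
  · intro hz
    obtain ⟨a, ha, rfl⟩ := mem_smul_set.mp hz
    rw [mem_arcIntegers_iff] at ha ⊢
    rw [smul_eq_mul, norm_mul, hu, one_mul]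
    exact ha
  · intro hz
    refine mem_smul_set.mpr ⟨u⁻¹ * z, ?_, by rw [smul_eq_mul, ← mul_assoc, mul_inv_cancel₀ hu0, one_mul]⟩
    rw [mem_arcIntegers_iff] at hz ⊢
    rw [norm_mul, norm_inv, hu, inv_one, one_mul]
    exact hz

/-- **[IUTchIII] Ex. 3.6 (ii), "`f·𝔍 = {f·𝔍_v}`" at `v ∈ 𝕍^arc`**: `f·(λ·𝒪_{K_v}) = (|f|·λ)·𝒪_{K_v}` — the
translate is again a positive real multiple of `𝒪_{K_v}` (for `f ≠ 0`), of parameter `|f|_v·λ`, i.e. class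
`β_v(f) + [λ]` in `Γ_v = ℝ` (`−log`-coordinates). [claim: Mochizuki2012, status: disputed] -/
theorem smul_smul_arcIntegers (f : ℂ) (lam : ℝ) :
    f • ((lam : ℂ) • arcIntegers) = ((‖f‖ * lam : ℝ) : ℂ) • arcIntegers := by
  rcases eq_or_ne f 0 with rfl | hf
  · simp only [norm_zero, zero_mul, Complex.ofReal_zero]
    rw [smul_smul, zero_mul]
  · -- `f = |f| · u` with `|u| = 1`
    have hnf : (‖f‖ : ℂ) ≠ 0 := by exact_mod_cast (norm_ne_zero_iff.mpr hf)
    have hu : ‖(‖f‖ : ℂ)⁻¹ * f‖ = 1 := by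
      rw [norm_mul, norm_inv, Complex.norm_real, Real.norm_of_nonneg (norm_nonneg f),
        inv_mul_cancel₀ (norm_ne_zero_iff.mpr hf)]
    calc f • ((lam : ℂ) • arcIntegers)
        = ((‖f‖ : ℂ) * (lam : ℂ)) • (((‖f‖ : ℂ)⁻¹ * f) • arcIntegers) := by
          rw [smul_smul, smul_smul]
          congr 1
          rw [mul_assoc, mul_comm (lam : ℂ), ← mul_assoc, ← mul_assoc, mul_inv_cancel₀ hnf, one_mul, mul_comm]
      _ = ((‖f‖ * lam : ℝ) : ℂ) • arcIntegers := by rw [unit_smul_arcIntegers hu, Complex.ofReal_mul]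

/-- **[IUTchIII] Ex. 3.6 (ii) / the dictionary of `GlobalFrobenioidModels.lean` at `v ∈ 𝕍^arc`, PROVED for the
literal sets: the elementary-morphism integrality condition "`f·𝔍_{1,v} ⊆ 𝔍_{2,v}`" (p. 108 l. 1–3) holds iff
`|f|_v·λ₁ ≤ λ₂`.** [claim: Mochizuki2012, status: disputed] -/
theorem smul_smul_arcIntegers_subset_iff (f : ℂ) {lam₁ lam₂ : ℝ} (h₁ : 0 < lam₁) (h₂ : 0 < lam₂) :
    f • ((lam₁ : ℂ) • arcIntegers) ⊆ (lam₂ : ℂ) • arcIntegers ↔ ‖f‖ * lam₁ ≤ lam₂ := by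
  constructor
  · intro h
    have hmem : f * (lam₁ : ℂ) ∈ (lam₂ : ℂ) • arcIntegers :=
      h (smul_mem_smul_set (self_mem_smul_arcIntegers (lam₁ : ℂ)))
    rw [mem_smul_arcIntegers_iff h₂, norm_mul, Complex.norm_real, Real.norm_of_nonneg h₁.le] at hmem
    exact hmem
  · intro h z hz
    rw [smul_smul_arcIntegers] at hz
    rcases (mul_nonneg (norm_nonneg f) h₁.le).eq_or_lt with h0 | hpos
    · -- `|f|·λ₁ = 0`, so `z = 0`
      rw [← h0] at hz
      obtain ⟨a, -, rfl⟩ := mem_smul_set.mp hz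
      rw [Complex.ofReal_zero, zero_smul]
      exact (mem_smul_arcIntegers_iff h₂).mpr (by rw [norm_zero]; exact h₂.le)
    · rw [mem_smul_arcIntegers_iff hpos] at hz
      exact (mem_smul_arcIntegers_iff h₂).mpr (hz.trans h)

/-- **The same in `Γ_v = ℝ` (`−log`-coordinates): `f·𝔍_{1,v} ⊆ 𝔍_{2,v}` ⟺ `β_v(f) + [λ₁] − [λ₂] ∈ Γ_v^{≥0}`**
with `β_v(f) = −log |f|_v`, `[λ] = −log λ` (the convention of abc-iut-L6-d1's `betaInf` / abc-iut-w4-d005's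
`Prop37.beta` at archimedean places), for `f ≠ 0`. [claim: Mochizuki2012, status: disputed] -/
theorem smul_smul_arcIntegers_subset_iff_log {f : ℂ} (hf : f ≠ 0) {lam₁ lam₂ : ℝ} (h₁ : 0 < lam₁)
    (h₂ : 0 < lam₂) :
    f • ((lam₁ : ℂ) • arcIntegers) ⊆ (lam₂ : ℂ) • arcIntegers ↔
      0 ≤ -Real.log ‖f‖ + -Real.log lam₁ - -Real.log lam₂ := by
  rw [smul_smul_arcIntegers_subset_iff f h₁ h₂]
  have hf' : 0 < ‖f‖ := norm_pos_iff.mpr hf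
  rw [show -Real.log ‖f‖ + -Real.log lam₁ - -Real.log lam₂ = Real.log lam₂ - Real.log (‖f‖ * lam₁) by
    rw [Real.log_mul hf'.ne' h₁.ne']; ring]
  rw [sub_nonneg, Real.log_le_log_iff (mul_pos hf' h₁) h₂]

/-- **The class `[λ] ∈ Γ_v` is well defined**: `λ₁·𝒪_{K_v} = λ₂·𝒪_{K_v}` iff `λ₁ = λ₂` (`λᵢ > 0`).
[claim: Mochizuki2012, status: disputed] -/
theorem smul_arcIntegers_eq_iff {lam₁ lam₂ : ℝ} (h₁ : 0 < lam₁) (h₂ : 0 < lam₂) :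
    (lam₁ : ℂ) • arcIntegers = (lam₂ : ℂ) • arcIntegers ↔ lam₁ = lam₂ := by
  refine ⟨fun h => le_antisymm ?_ ?_, fun h => by rw [h]⟩
  · have := (smul_smul_arcIntegers_subset_iff 1 h₁ h₂).mp (by rw [one_smul]; exact h.le)
    simpa using this
  · have := (smul_smul_arcIntegers_subset_iff 1 h₂ h₁).mp (by rw [one_smul]; exact h.ge)
    simpa using this

/-- **[IUTchIII] Ex. 3.6 (ii), tensor powers/products at `v ∈ 𝕍^arc`**: `(λ₁·𝒪_{K_v})·(λ₂·𝒪_{K_v}) =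
(λ₁λ₂)·𝒪_{K_v}` as subsets of `ℂ` (product of classes = sum in `Γ_v = ℝ`). [claim: Mochizuki2012, status: disputed] -/
theorem smul_arcIntegers_mul {lam₁ lam₂ : ℝ} (h₁ : 0 < lam₁) (h₂ : 0 < lam₂) :
    (lam₁ : ℂ) • arcIntegers * (lam₂ : ℂ) • arcIntegers = ((lam₁ * lam₂ : ℝ) : ℂ) • arcIntegers := by
  ext z
  rw [mem_smul_arcIntegers_iff (mul_pos h₁ h₂), Set.mem_mul]
  constructor
  · rintro ⟨x, hx, y, hy, rfl⟩
    rw [mem_smul_arcIntegers_iff h₁] at hx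
    rw [mem_smul_arcIntegers_iff h₂] at hy
    rw [norm_mul]
    exact mul_le_mul hx hy (norm_nonneg y) h₁.le
  · intro hz
    refine ⟨(lam₁ : ℂ), (mem_smul_arcIntegers_iff h₁).mpr ?_, (lam₁ : ℂ)⁻¹ * z,
      (mem_smul_arcIntegers_iff h₂).mpr ?_, ?_⟩
    · rw [Complex.norm_real, Real.norm_of_nonneg h₁.le]
    · rw [norm_mul, norm_inv, Complex.norm_real, Real.norm_of_nonneg h₁.le, inv_mul_le_iff₀ h₁]
      exact hz
    · have h0 : (lam₁ : ℂ) ≠ 0 := by exact_mod_cast h₁.ne'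
      rw [← mul_assoc, mul_inv_cancel₀ h0, one_mul]

/-- `λ·𝒪_{K_v}` is stable under multiplication by `𝒪_{K_v}` (sub-multiplicativity of `|·|`), also at an
archimedean place. [claim: Mochizuki2012, status: disputed] -/
theorem mul_mem_smul_arcIntegers (lam : ℂ) {c x : ℂ} (hc : c ∈ arcIntegers) (hx : x ∈ lam • arcIntegers) :
    c * x ∈ lam • arcIntegers := by
  obtain ⟨a, ha, rfl⟩ := mem_smul_set.mp hx
  refine mem_smul_set.mpr ⟨c * a, ?_, by rw [smul_eq_mul, smul_eq_mul, mul_left_comm]⟩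
  rw [mem_arcIntegers_iff] at ha hc ⊢
  calc ‖c * a‖ = ‖c‖ * ‖a‖ := norm_mul c a
    _ ≤ 1 * 1 := mul_le_mul hc ha (norm_nonneg a) zero_le_one
    _ = 1 := one_mul 1

/-- **Why [IUTchIII] Prop. 3.7 (ii) says "indeed a submodule when `v ∈ 𝕍^non`" and not at `v ∈ 𝕍^arc`**: at an
archimedean place `λ·𝒪_{K_v}` (`λ ≠ 0`) is NOT closed under addition — `λ ∈ λ·𝒪_{K_v}` but `λ + λ ∉ λ·𝒪_{K_v}`
(norm `2|λ| > |λ|`). Contrast the ultrametric `add_mem_smul_closedBall` of the nonarchimedean twin.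
[claim: Mochizuki2012, status: disputed] -/
theorem not_addClosed_smul_arcIntegers {lam : ℂ} (hlam : lam ≠ 0) :
    ∃ x ∈ lam • arcIntegers, ∃ y ∈ lam • arcIntegers, x + y ∉ lam • arcIntegers := by
  refine ⟨lam, self_mem_smul_arcIntegers lam, lam, self_mem_smul_arcIntegers lam, ?_⟩
  intro hmem
  obtain ⟨a, ha, h⟩ := mem_smul_set.mp hmem
  rw [mem_arcIntegers_iff] at ha
  have h2 : lam * a = lam * 2 := by rw [← smul_eq_mul, h]; ring
  have ha2 : a = 2 := mul_left_cancel₀ hlam h2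
  rw [ha2] at ha
  norm_num at ha

/-! ### `𝓘^ℚ` at an archimedean place is all of `K_v`; Prop. 3.7 (ii)'s parenthetical -/

/-- Every `z ∈ ℂ` is an integer multiple of an element of the log-shell `ℐ = {|a| ≤ π}`: `z = n·(z/n)` with
`|z/n| ≤ π` for `n > |z|/π`. Hence **the additive subgroup generated by the archimedean log-shell is all of
`K_v`**. [claim: Mochizuki2012, status: disputed] -/
theorem addSubgroupClosure_arcLogShell_eq_top : AddSubgroup.closure arcLogShell = ⊤ := by
  rw [eq_top_iff]
  intro z _
  obtain ⟨n, hn⟩ := exists_nat_gt (‖z‖ / Real.pi)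
  have hnpos : (0 : ℝ) < n := lt_of_le_of_lt (div_nonneg (norm_nonneg z) Real.pi_pos.le) hn
  have hmem : (n : ℂ)⁻¹ * z ∈ arcLogShell := by
    show ‖(n : ℂ)⁻¹ * z‖ ≤ Real.pi
    rw [norm_mul, norm_inv, Complex.norm_natCast, inv_mul_le_iff₀ hnpos]
    rw [div_lt_iff₀ Real.pi_pos] at hn
    linarith
  have hz : z = (n : ℕ) • ((n : ℂ)⁻¹ * z) := by
    rw [nsmul_eq_mul, ← mul_assoc, mul_inv_cancel₀ (by exact_mod_cast hnpos.ne'), one_mul]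
  rw [hz]
  exact AddSubgroup.nsmul_mem _ (AddSubgroup.subset_closure hmem) n

/-- **`𝓘^ℚ(𝓕_v) = K_v` at an archimedean place**, in abc-iut-L6-t4's typing `shellQSpan 𝕜 (⟨ℐ⟩)` ([IUTchIII]
Prop. 3.2 (ii), the span of the subgroup generated by the log-shell), for EVERY coefficient field `𝕜` acting on
`ℂ` (print's `ℚ`; the `ℝ` of the Hermitian-metric reading). [claim: Mochizuki2012, status: disputed] -/
theorem shellQSpan_arcLogShell_eq_top (𝕜 : Type) [Field 𝕜] [Module 𝕜 ℂ] :
    shellQSpan 𝕜 (AddSubgroup.closure arcLogShell) = ⊤ := by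
  rw [eq_top_iff]
  intro z _
  apply Submodule.subset_span
  show z ∈ AddSubgroup.closure arcLogShell
  rw [addSubgroupClosure_arcLogShell_eq_top]
  trivial

/-- **[IUTchIII] Prop. 3.7 (ii), "is a subset … of `𝓘^ℚ(^{A,α}𝓕_v)`"** at an archimedean place: `λ·𝒪_{K_v} ⊆ 𝓘^ℚ`
(for ANY `λ`, any coefficient field `𝕜`). [claim: Mochizuki2012, status: disputed] -/
theorem smul_arcIntegers_subset_shellQSpan (𝕜 : Type) [Field 𝕜] [Module 𝕜 ℂ] (lam : ℂ) :
    lam • arcIntegers ⊆ (shellQSpan 𝕜 (AddSubgroup.closure arcLogShell) : Set ℂ) := by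
  intro z _
  have h : z ∈ (⊤ : Submodule 𝕜 ℂ) := Submodule.mem_top
  rwa [← shellQSpan_arcLogShell_eq_top 𝕜] at h

/-- **[IUTchIII] Prop. 3.7 (ii), "whose `ℚ`-span is equal to `𝓘^ℚ(^{A,α}𝓕_v)`" with the LITERAL `ℚ`-span of print**,
at an archimedean place: for `λ ≠ 0` the `ℚ`-span of `λ·𝒪_{K_v}` is all of `K_v` (`z = n·(λ·a)` with
`a = z/(nλ)`, `|a| ≤ 1` for `n ≥ |z|/|λ|`). [claim: Mochizuki2012, status: disputed] -/
theorem span_rat_smul_arcIntegers_eq_top {lam : ℂ} (hlam : lam ≠ 0) :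
    Submodule.span ℚ (lam • arcIntegers) = ⊤ := by
  rw [eq_top_iff]
  intro z _
  have hlampos : 0 < ‖lam‖ := norm_pos_iff.mpr hlam
  obtain ⟨n, hn⟩ := exists_nat_gt (‖z‖ / ‖lam‖)
  have hnpos : (0 : ℝ) < n := lt_of_le_of_lt (div_nonneg (norm_nonneg z) hlampos.le) hn
  have hn0 : (n : ℂ) ≠ 0 := by exact_mod_cast hnpos.ne'
  -- `a := z / (n λ)` lies in the unit disc
  have ha : (n : ℂ)⁻¹ * lam⁻¹ * z ∈ arcIntegers := by
    rw [mem_arcIntegers_iff, norm_mul, norm_mul, norm_inv, norm_inv, Complex.norm_natCast]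
    rw [div_lt_iff₀ hlampos] at hn
    rw [mul_assoc, inv_mul_le_iff₀ hnpos, inv_mul_le_iff₀ hlampos, mul_one]
    linarith [mul_comm (n : ℝ) ‖lam‖]
  have hmem : lam • ((n : ℂ)⁻¹ * lam⁻¹ * z) ∈ Submodule.span ℚ (lam • arcIntegers) :=
    Submodule.subset_span (smul_mem_smul_set ha)
  have h := Submodule.smul_mem (Submodule.span ℚ (lam • arcIntegers)) (n : ℚ) hmem
  have hcalc : (n : ℚ) • (lam • ((n : ℂ)⁻¹ * lam⁻¹ * z)) = z := by
    rw [smul_eq_mul, Rat.smul_def, Rat.cast_natCast]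
    field_simp
  rwa [hcalc] at h

/-- The `ℝ`-span version (abc-iut-L6-t4's `𝕜 = ℝ` reading of `𝓘^ℚ` at archimedean places): the `ℝ`-span of
`λ·𝒪_{K_v}` (`λ ≠ 0`) is all of `K_v`. [claim: Mochizuki2012, status: disputed] -/
theorem span_real_smul_arcIntegers_eq_top {lam : ℂ} (hlam : lam ≠ 0) :
    Submodule.span ℝ (lam • arcIntegers) = ⊤ := by
  rw [eq_top_iff]
  intro z _
  have h : z ∈ (Submodule.span ℚ (lam • arcIntegers)).restrictScalars ℚ := by
    rw [Submodule.restrictScalars_self, span_rat_smul_arcIntegers_eq_top hlam]; trivial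
  exact Submodule.span_le_restrictScalars ℚ ℝ _ h

/-- **[IUTchIII] Prop. 3.7 (ii), "whose `ℚ`-span is equal to `𝓘^ℚ(^{A,α}𝓕_v)`"** at an archimedean place, in the
tree's vocabulary: the `ℚ`-span of `λ·𝒪_{K_v}` (`λ ≠ 0`) EQUALS `𝓘^ℚ = shellQSpan ℚ ⟨ℐ⟩` (both are all of `K_v`).
[claim: Mochizuki2012, status: disputed] -/
theorem span_rat_smul_arcIntegers_eq_shellQSpan {lam : ℂ} (hlam : lam ≠ 0) :
    Submodule.span ℚ (lam • arcIntegers) = shellQSpan ℚ (AddSubgroup.closure arcLogShell) := by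
  rw [span_rat_smul_arcIntegers_eq_top hlam, shellQSpan_arcLogShell_eq_top ℚ]

/-- The same with `ℝ`-coefficients. [claim: Mochizuki2012, status: disputed] -/
theorem span_real_smul_arcIntegers_eq_shellQSpan {lam : ℂ} (hlam : lam ≠ 0) :
    Submodule.span ℝ (lam • arcIntegers) = shellQSpan ℝ (AddSubgroup.closure arcLogShell) := by
  rw [span_real_smul_arcIntegers_eq_top hlam, shellQSpan_arcLogShell_eq_top ℝ]

/-- `𝒪_{K_v} ⊆ ℐ ⊆ 𝓘^ℚ` and `λ·𝒪_{K_v} ⊆ 𝓘^ℚ` assembled: **the archimedean parenthetical of [IUTchIII] Prop. 3.7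
(ii) at the one-factor model** — for every positive real `λ`, `𝔍_v := λ·𝒪_{K_v}` is a subset of `𝓘^ℚ` whose
`ℚ`-span equals `𝓘^ℚ`, and it contains its generator. [claim: Mochizuki2012, status: disputed] -/
theorem prop37ii_arch_parenthetical {lam : ℝ} (hlam : 0 < lam) :
    (lam : ℂ) • arcIntegers ⊆ (shellQSpan ℚ (AddSubgroup.closure arcLogShell) : Set ℂ) ∧
      Submodule.span ℚ ((lam : ℂ) • arcIntegers) = shellQSpan ℚ (AddSubgroup.closure arcLogShell) ∧
      (lam : ℂ) ∈ (lam : ℂ) • arcIntegers :=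
  ⟨smul_arcIntegers_subset_shellQSpan ℚ _,
    span_rat_smul_arcIntegers_eq_shellQSpan (by exact_mod_cast hlam.ne'), self_mem_smul_arcIntegers _⟩

end ArchPlace

end Literature.IUT.LogThetaLattice

end
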